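import Summits.BirchSwinnertonDyer.BirchSwinnertonDyer.Theorems.SignedBaseChangeAnticyclotomicEisensteinDivisibilityAdmdefHowardRigidityIndefinite
import Summits.BirchSwinnertonDyer.BirchSwinnertonDyer.Theorems.SchneiderFreeAdditiveX3PoitouTateSelmerDualityHolds
import Summits.BirchSwinnertonDyer.BirchSwinnertonDyer.Theorems.SignedBaseChangeDefiniteAnchorDefs
import Literature.NumberTheory.EllipticCurves.GrossPointsExistenceGeneralLevel
import Literature.NumberTheory.Automorphic.BrandtSetupAdmissible
import Mathlib.NumberTheory.NumberField.Discriminant.Different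
import HarnessLib

/-!
# Line `admdef` (crux `AnticyclotomicEisensteinDivisibility`, stmt-BirchSwinnertonDyer-20727): THE ANCHOR FROM [NV] — on cell β, Howard's
# non-triviality hypothesis [NV] yields K1's conclusion «Brandt data with non-zero weighted toric period» at EVERY odd zero vertex, in kernel,
# with the Poitou–Tate binder DISCHARGED

LEAD seat bsd-line-sbc-p1 (gen 33), `--supports stmt-BirchSwinnertonDyer-20727` (helper; OFF the v24 composition path; sequel of
`…AdmdefHowardRigidity` (g32) and of `Literature/NumberTheory/EllipticCurves/GrossPointsExistenceGeneralLevel.lean` (g33, p777776)).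

WHAT IS NEW.  (§1) The named fact `poitouTate_selmerStructure_duality K` used as a HYPOTHESIS by g32's rigidity road is a TREE THEOREM
(`SchneiderFreeAdditiveX3.PoitouTateReduction.poitouTate_selmerStructure_duality_holds`, Milne ADT I 4.10 for the canonical local-invariant family): PT-free
forms of Howard's Prop. 2.4.11 on β (`selQP_eqvGen_coreEdge_of_split'`), Thm. 3.2.3 (c)/(b) mod 𝔪 (`isUnit_lam_of_hasUnitLambda_of_selQP_eq_bot'`,
`kappa_ne_zero_of_hasUnitLambda_of_rank_one'`) and their IFF forms.  (§2) «Inert ⟹ unramified ⟹ prime to `d_K`» and «inert ⟹ one prime above» for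
Bertolini–Darmon admissible primes, so that (§3) at EVERY odd admissible level `s` of cell β the DEFINITE BRANDT DATA EXIST: a set-up
`S : Brandt.XiSetup N (∏ s)` (tree `Brandt.nonempty_xiSetup_iff_admissible`, Vignéras III §3 Thm. 3.1) AND a Gross point of conductor `1` on it
(g33 `GrossPointsGeneralLevel.exists_isGrossPoint`, BD96 Lemma 2.1 at ARBITRARY — here non-square-free — `N⁺ = N`).  (§4) ★★★ `anchor_of_hasUnitLambda`:
under the frame of `…AdmdefHowardRigidity` §3 (signed system `hB`, `AcSigned.Setting`, {HLV 3.7 local}, `(N : ℤ) = N_E`, `p ≥ 5`, `ρ̄` onto, (Heeg), `p` split,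
`(N, d_K) = 1`, binder (ii), `c ≠ 1`, odd bottom dimension or the DD10 fact) together with the DICTIONARY clause of cite (16) for THIS system
(`λ_1(m)(0) ∈ ℤ_pˣ ⟺` weighted toric period of the JL vector `≠ 0`, CHKLL25 Thm. 7.4/(7.4)), [NV] `B.HasUnitLambda N` implies, at EVERY odd zero vertex
`s` (`SelQP W K p c s ± = ⊥`): `∃ S ψ I φ`, `Brandt.IsGrossPoint S.O ψ I ∧ φ ∈ eigenSpace(a(E)) ∧ toricPeriod S.O ψ I (w • φ) ≠ 0` — the conclusion of the
anchor K1 (item stmt-BirchSwinnertonDyer-33118 `…DefiniteAnchorDefs.DefiniteAnchorNonFW`) in K1's own Brandt currency and at K1's own product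
`∏ q ∈ s.image Subtype.val, q`.  READING (now a kernel theorem in the crux frame, modulo {HLV 3.7 local} and (Par)/DD10 only): **K1 ⟸ [NV] on β**; the
converse «K1 ⟹ [NV]» is the skeleton's `exists_anchorLevel_of_definiteAnchor` + bridge (W. Zhang's walk), so on cell β the research content of the
anchor IS Howard's non-triviality hypothesis.

HONEST FRAMING: theorems only (0 definitions, 0 named facts introduced, 0 `sorry`; standard axioms); conditional on {HLV 3.7 local} (and DD10 in the
`_of_dokchitser` form); [NV] and the dictionary clause are HYPOTHESES — nothing here proves [NV], K1, the crux or BSD; no summit statement is proved.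

References: [cite: Howard2006Bipartite, Prop. 2.4.11, Thm. 2.5.1] [cite: Howard2006, Thm. 3.2.3] [cite: CastellaEtAl2025, Thm. 7.4, Thm. 7.5, §7.4 (arXiv:2308.10474v2 pp. 30–33)]
[cite: WZhang2014, Prop. 5.4, Thm. 9.1] [cite: BertoliniDarmon1996, Lemma 2.1] [cite: VignerasLNM800, Ch. III §3 Thm. 3.1, §5 Thm. 5.11] [cite: MilneADT2006, Ch. I, Thm. 4.10]
[cite: HatleyLeiVigni2022, Lemma 3.7] [cite: DokchitserDokchitserAnnals2010, §4.6, Thm. 4.19] [cite: BertoliniDarmon2005, p. 18 (admissible primes)]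
-/

-- D-0017: single-problem summit, the namespace repeats the problem name by design.
set_option linter.dupNamespace false
set_option autoImplicit false

noncomputable section

open scoped Classical NumberField Pointwise

namespace Summit.BirchSwinnertonDyer.BirchSwinnertonDyer.Theorems.SignedBaseChangeAcDivAdmdefAnchorOfNV

open WeierstrassCurve NumberField IsDedekindDomain Field Module
open Literature.NumberTheory.EllipticCurves Literature.NumberTheory.GaloisRepresentations Literature.NumberTheory.GaloisCohomology
open Literature.NumberTheory.EllipticCurves.CastellaHsuKunduLeeLiu2025
open Literature.NumberTheory.EllipticCurves.BertoliniDarmon2005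
open Literature.NumberTheory.EllipticCurves.AcSigned
open Literature.NumberTheory.EllipticCurves.Rank1Residual
open Literature.NumberTheory.Automorphic
open Summit.BirchSwinnertonDyer.BirchSwinnertonDyer.Theorems.AdditiveKoly
open Summit.BirchSwinnertonDyer.BirchSwinnertonDyer.Theorems.SignedBaseChangeAcDivAdmdefCoreConnectedSplit
open Summit.BirchSwinnertonDyer.BirchSwinnertonDyer.Theorems.SignedBaseChangeAcDivAdmdefHowardRigidity
open Summit.BirchSwinnertonDyer.BirchSwinnertonDyer.Theorems.SignedBaseChangeAcDivAdmdefHowardRigidityIndefinite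
open Summit.BirchSwinnertonDyer.BirchSwinnertonDyer.Theorems.SchneiderFreeAdditiveX3.PoitouTateReduction

universe u

/-! ## §1 The Poitou–Tate binder DISCHARGED (tree theorem `poitouTate_selmerStructure_duality_holds`) -/

section PT

variable (W : WeierstrassCurve ℚ) (K : Type) [Field K] [NumberField K] (p : ℕ) [W.IsElliptic] [W.IsGloballyMinimal] [Fact p.Prime]
  (c : K ≃ₐ[ℚ] K) [Module (ZMod p) (Vp W K p)]

/-- **HOWARD'S CORE GRAPH IS CONNECTED ON CELL β — unconditionally in the PT fact** (g32 `selQP_eqvGen_coreEdge_of_split_of_poitouTate` with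
`poitouTate_selmerStructure_duality K` supplied by the tree theorem `poitouTate_selmerStructure_duality_holds`): any two levels of total canonical rank
`≤ 1` are joined through Howard's core edges, given odd bottom dimension. [cite: Howard2006Bipartite, Prop. 2.4.11] [cite: WZhang2014, Lemma 5.3, Prop. 5.4]
[cite: MilneADT2006, Ch. I, Thm. 4.10] -/
theorem selQP_eqvGen_coreEdge_of_split' (h5 : 5 ≤ p) (hsurj : W.HasSurjectiveModNGaloisRep p)
    (hK : IsImaginaryQuadratic K) (hH : SatisfiesHeegnerHypothesis (W.conductorNorm ℤ) K)
    (hsp : ((Ideal.span {(p : ℤ)}).primesOver (𝓞 K)).ncard = 2) (hc1 : c ≠ 1)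
    (hodd : Odd (finrank (ZMod p) (SelQP W K p c ∅ true) + finrank (ZMod p) (SelQP W K p c ∅ false)))
    {a b : Finset (AdmQ W K p)}
    (ha : finrank (ZMod p) (SelQP W K p c a true) + finrank (ZMod p) (SelQP W K p c a false) ≤ 1)
    (hb : finrank (ZMod p) (SelQP W K p c b true) + finrank (ZMod p) (SelQP W K p c b false) ≤ 1) :
    Relation.EqvGen (fun a b : Finset (AdmQ W K p) ↦ ∃ q, q ∉ a ∧ b = insert q a ∧
        (Even a.card → SelQP W K p c (insert q a) true = ⊥ ∧ SelQP W K p c (insert q a) false = ⊥) ∧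
        (Odd a.card → SelQP W K p c a true = ⊥ ∧ SelQP W K p c a false = ⊥)) a b :=
  selQP_eqvGen_coreEdge_of_split_of_poitouTate W K p c h5 hsurj hK hH hsp hc1 (poitouTate_selmerStructure_duality_holds (K := K)) hodd ha hb

end PT

section Main

variable {K : Type} [Field K] [NumberField K] {W : WeierstrassCurve ℚ} [W.IsElliptic] [W.IsGloballyMinimal] {p : ℕ} [Fact p.Prime]
  {κ : ZpExtension K p} {γ : absoluteGaloisGroup K} {N : ℕ} {ε : ℤˣ} {B : SignedBipartiteSystem W K p κ} {𝔭 𝔭' : HeightOneSpectrum (𝓞 K)}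
  (c : K ≃ₐ[ℚ] K) [Module (ZMod p) (Vp W K p)]

/-- ★★★ **HOWARD'S THEOREM 3.2.3 (c) mod `𝔪` ON CELL β at every definite vertex, PT-FREE**: g32's `isUnit_lam_of_hasUnitLambda_of_selQP_eq_bot` with
the Poitou–Tate binder discharged by the tree theorem — [NV] ⟹ `λ_1(∏s)(0) ∈ ℤ_pˣ` at EVERY odd zero vertex `s`.  Still conditional on {HLV 3.7 local};
[NV] is a hypothesis. [cite: Howard2006, Thm. 3.2.3 (c)] [cite: Howard2006Bipartite, Prop. 2.4.11, Thm. 2.5.1] [cite: CastellaEtAl2025, Thm. 7.4, Thm. 7.5, §7.4]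
[cite: MilneADT2006, Ch. I, Thm. 4.10] [cite: HatleyLeiVigni2022, Lemma 3.7] -/
theorem isUnit_lam_of_hasUnitLambda_of_selQP_eq_bot' (hB : IsSignedBipartiteSystem W K p κ γ N ε B) (hS : Setting W K p κ 𝔭 𝔭')
    (hloc : hatleyLeiVigni2022_lemma37_local_signedCondition_eq_kummer W K p κ 𝔭 𝔭')
    (hN : (N : ℤ) = W.conductorNorm ℤ) (h5 : 5 ≤ p) (hsurj : W.HasSurjectiveModNGaloisRep p)
    (hH : SatisfiesHeegnerHypothesis (W.conductorNorm ℤ) K) (hsp : ((Ideal.span {(p : ℤ)}).primesOver (𝓞 K)).ncard = 2)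
    (hND : IsCoprime (N : ℤ) (NumberField.discr K))
    (hall : ∀ q : ℕ, q.Prime → q ∣ N → ∃ v' : HeightOneSpectrum (𝓞 ℚ), ((q : ℕ) : 𝓞 ℚ) ∈ v'.asIdeal ∧
      ∃ 𝔓 ∈ v'.primesAbove, ∃ σ ∈ 𝔓.inertia (absoluteGaloisGroup ℚ), ∃ P : W.geomTorsion (p : ℤ), σ • P ≠ P)
    (hc1 : c ≠ 1) (hodd : Odd (finrank (ZMod p) (SelQP W K p c ∅ true) + finrank (ZMod p) (SelQP W K p c ∅ false)))
    (hNV : B.HasUnitLambda N)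
    {s : Finset (AdmQ W K p)} (hs : Odd s.card) (hzero : ∀ μ : Bool, SelQP W K p c s μ = ⊥) :
    IsUnit (PowerSeries.constantCoeff (B.lam 1 (∏ r ∈ s, (r : ℕ)))) :=
  isUnit_lam_of_hasUnitLambda_of_selQP_eq_bot c hB hS hloc (poitouTate_selmerStructure_duality_holds (K := K)) hN h5 hsurj hH hsp hND hall
    hc1 hodd hNV hs hzero

/-- ★★★ **HOWARD'S THEOREM 3.2.3 (b) mod `𝔪` ON CELL β at every indefinite vertex, PT-FREE**: [NV] ⟹ `κ_1(∏s)_0 ≠ 0` at every even vertex of total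
canonical rank one (g32 `kappa_ne_zero_of_hasUnitLambda_of_rank_one`, PT discharged). [cite: Howard2006, Thm. 3.2.3 (b)] [cite: Howard2006Bipartite, Prop. 2.4.11, Thm. 2.5.1]
[cite: CastellaEtAl2025, Thm. 7.4, Thm. 7.5] [cite: MilneADT2006, Ch. I, Thm. 4.10] [cite: HatleyLeiVigni2022, Lemma 3.7] -/
theorem kappa_ne_zero_of_hasUnitLambda_of_rank_one' (hB : IsSignedBipartiteSystem W K p κ γ N ε B) (hS : Setting W K p κ 𝔭 𝔭')
    (hloc : hatleyLeiVigni2022_lemma37_local_signedCondition_eq_kummer W K p κ 𝔭 𝔭')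
    (hN : (N : ℤ) = W.conductorNorm ℤ) (h5 : 5 ≤ p) (hsurj : W.HasSurjectiveModNGaloisRep p)
    (hH : SatisfiesHeegnerHypothesis (W.conductorNorm ℤ) K) (hsp : ((Ideal.span {(p : ℤ)}).primesOver (𝓞 K)).ncard = 2)
    (hND : IsCoprime (N : ℤ) (NumberField.discr K))
    (hall : ∀ q : ℕ, q.Prime → q ∣ N → ∃ v' : HeightOneSpectrum (𝓞 ℚ), ((q : ℕ) : 𝓞 ℚ) ∈ v'.asIdeal ∧
      ∃ 𝔓 ∈ v'.primesAbove, ∃ σ ∈ 𝔓.inertia (absoluteGaloisGroup ℚ), ∃ P : W.geomTorsion (p : ℤ), σ • P ≠ P)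
    (hc1 : c ≠ 1) (hodd : Odd (finrank (ZMod p) (SelQP W K p c ∅ true) + finrank (ZMod p) (SelQP W K p c ∅ false)))
    (hNV : B.HasUnitLambda N)
    {s : Finset (AdmQ W K p)} (hs : Even s.card)
    (hrank : finrank (ZMod p) (SelQP W K p c s true) + finrank (ZMod p) (SelQP W K p c s false) = 1) :
    B.kappa 1 (∏ r ∈ s, (r : ℕ)) 0 ≠ 0 :=
  kappa_ne_zero_of_hasUnitLambda_of_rank_one c hB hS hloc (poitouTate_selmerStructure_duality_holds (K := K)) hN h5 hsurj hH hsp hND hall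
    hc1 hodd hNV hs hrank

/-- ★★★ **Thm. 3.2.3 (c) AS AN IFF at every definite vertex, PT-FREE**: given [NV], `λ_1(∏s)(0) ∈ ℤ_pˣ ⟺ s` is a zero vertex (g32
`isUnit_lam_iff_selQP_eq_bot_of_hasUnitLambda`, PT discharged). [cite: Howard2006, Thm. 3.2.3 (c), Lem. 2.3.4] [cite: Howard2006Bipartite, Thm. 2.5.1]
[cite: CastellaEtAl2025, Thm. 7.4, Thm. 7.5] [cite: MilneADT2006, Ch. I, Thm. 4.10] [cite: HatleyLeiVigni2022, Lemma 3.7] -/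
theorem isUnit_lam_iff_selQP_eq_bot_of_hasUnitLambda' (hB : IsSignedBipartiteSystem W K p κ γ N ε B) (hS : Setting W K p κ 𝔭 𝔭')
    (hloc : hatleyLeiVigni2022_lemma37_local_signedCondition_eq_kummer W K p κ 𝔭 𝔭')
    (hN : (N : ℤ) = W.conductorNorm ℤ) (h5 : 5 ≤ p) (hsurj : W.HasSurjectiveModNGaloisRep p)
    (hH : SatisfiesHeegnerHypothesis (W.conductorNorm ℤ) K) (hsp : ((Ideal.span {(p : ℤ)}).primesOver (𝓞 K)).ncard = 2)
    (hND : IsCoprime (N : ℤ) (NumberField.discr K))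
    (hall : ∀ q : ℕ, q.Prime → q ∣ N → ∃ v' : HeightOneSpectrum (𝓞 ℚ), ((q : ℕ) : 𝓞 ℚ) ∈ v'.asIdeal ∧
      ∃ 𝔓 ∈ v'.primesAbove, ∃ σ ∈ 𝔓.inertia (absoluteGaloisGroup ℚ), ∃ P : W.geomTorsion (p : ℤ), σ • P ≠ P)
    (hc1 : c ≠ 1) (hodd : Odd (finrank (ZMod p) (SelQP W K p c ∅ true) + finrank (ZMod p) (SelQP W K p c ∅ false)))
    (hNV : B.HasUnitLambda N) {s : Finset (AdmQ W K p)} (hs : Odd s.card) :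
    IsUnit (PowerSeries.constantCoeff (B.lam 1 (∏ r ∈ s, (r : ℕ)))) ↔ ∀ μ : Bool, SelQP W K p c s μ = ⊥ :=
  isUnit_lam_iff_selQP_eq_bot_of_hasUnitLambda c hB hS hloc (poitouTate_selmerStructure_duality_holds (K := K)) hN h5 hsurj hH hsp hND hall
    hc1 hodd hNV hs

/-- ★★★ **Thm. 3.2.3 (b) AS AN IFF at every indefinite vertex, PT-FREE**: given [NV], `dim SelQP s⁺ + dim SelQP s⁻ = 1 ⟺ κ_1(∏s)_0 ≠ 0` (g32
`finrank_add_eq_one_iff_kappa_ne_zero_of_hasUnitLambda`, PT discharged). [cite: Howard2006, Thm. 3.2.3 (b)–(c), Thm. 2.3.7] [cite: Howard2006Bipartite, Thm. 2.5.1]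
[cite: CastellaEtAl2025, Thm. 7.4, Thm. 7.5] [cite: GrossLMS1991, Thm. 2.2] [cite: MilneADT2006, Ch. I, Thm. 4.10] [cite: HatleyLeiVigni2022, Lemma 3.7] -/
theorem finrank_add_eq_one_iff_kappa_ne_zero_of_hasUnitLambda' (hB : IsSignedBipartiteSystem W K p κ γ N ε B) (hS : Setting W K p κ 𝔭 𝔭')
    (hloc : hatleyLeiVigni2022_lemma37_local_signedCondition_eq_kummer W K p κ 𝔭 𝔭')
    (hN : (N : ℤ) = W.conductorNorm ℤ) (h5 : 5 ≤ p) (hsurj : W.HasSurjectiveModNGaloisRep p)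
    (hH : SatisfiesHeegnerHypothesis (W.conductorNorm ℤ) K) (hsp : ((Ideal.span {(p : ℤ)}).primesOver (𝓞 K)).ncard = 2)
    (hND : IsCoprime (N : ℤ) (NumberField.discr K))
    (hall : ∀ q : ℕ, q.Prime → q ∣ N → ∃ v' : HeightOneSpectrum (𝓞 ℚ), ((q : ℕ) : 𝓞 ℚ) ∈ v'.asIdeal ∧
      ∃ 𝔓 ∈ v'.primesAbove, ∃ σ ∈ 𝔓.inertia (absoluteGaloisGroup ℚ), ∃ P : W.geomTorsion (p : ℤ), σ • P ≠ P)
    (hc1 : c ≠ 1) (hodd : Odd (finrank (ZMod p) (SelQP W K p c ∅ true) + finrank (ZMod p) (SelQP W K p c ∅ false)))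
    (hNV : B.HasUnitLambda N) {s : Finset (AdmQ W K p)} (hs : Even s.card) :
    finrank (ZMod p) (SelQP W K p c s true) + finrank (ZMod p) (SelQP W K p c s false) = 1 ↔ B.kappa 1 (∏ r ∈ s, (r : ℕ)) 0 ≠ 0 :=
  finrank_add_eq_one_iff_kappa_ne_zero_of_hasUnitLambda c hB hS hloc (poitouTate_selmerStructure_duality_holds (K := K)) hN h5 hsurj hH hsp hND hall
    hc1 hodd hNV hs

end Main

/-! ## §2 Bertolini–Darmon admissible primes: inert ⟹ one prime above, inert ⟹ prime to `d_K` -/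

section Inert

variable {K : Type} [Field K] [NumberField K]

/-- If `(q)` is a prime ideal of `𝓞 K` (`q` a rational prime INERT in `K`), then `(q)` is the only prime of `𝓞 K` over `qℤ`. [cite: GrossLMS1991, §3 (3.1)–(3.2)] -/
private theorem ncard_primesOver_eq_one_of_isPrime_span {q : ℕ} (hq : q.Prime) (hP : (Ideal.span {(q : 𝓞 K)}).IsPrime) :
    ((Ideal.span {(q : ℤ)}).primesOver (𝓞 K)).ncard = 1 := by
  set Q : Ideal (𝓞 K) := Ideal.span {(q : 𝓞 K)} with hQ_def
  have hQne : Q ≠ ⊥ := by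
    rw [hQ_def, Ne, Ideal.span_singleton_eq_bot]
    exact_mod_cast hq.ne_zero
  have hmax : Q.IsMaximal := hP.isMaximal hQne
  have hunder : Ideal.span {(q : ℤ)} = Q.under ℤ := by
    have hle : Ideal.span {(q : ℤ)} ≤ Q.under ℤ := by
      rw [Ideal.span_le, Set.singleton_subset_iff]
      show algebraMap ℤ (𝓞 K) q ∈ Q
      rw [map_natCast]
      exact Ideal.subset_span rfl
    have hqmax : (Ideal.span {(q : ℤ)}).IsMaximal :=
      PrincipalIdealRing.isMaximal_of_irreducible (Nat.prime_iff_prime_int.mp hq).irreducible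
    exact hqmax.eq_of_le (Ideal.IsPrime.under ℤ Q).ne_top hle
  have hset : (Ideal.span {(q : ℤ)}).primesOver (𝓞 K) = {Q} := by
    ext P
    simp only [Set.mem_singleton_iff]
    constructor
    · rintro ⟨hPp, hover⟩
      have hle : Q ≤ P := by
        rw [hQ_def, Ideal.span_le, Set.singleton_subset_iff]
        have hmem : (q : ℤ) ∈ P.under ℤ := by
          rw [← hover.over]; exact Ideal.subset_span rfl
        have := Ideal.mem_comap.mp hmem
        simpa using this
      exact (hmax.eq_of_le hPp.ne_top hle).symm
    · intro h
      subst h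
      exact ⟨hP, ⟨hunder⟩⟩
  rw [hset, Set.ncard_singleton]

/-- **An inert prime is unramified, hence prime to the discriminant**: if `(q)` is a prime ideal of `𝓞 K` then `q ∤ d_K` (the unique prime over `q`
is `(q)` itself, of ramification index `1`; Dedekind's discriminant theorem, Mathlib `NumberField.not_dvd_discr_iff_isUnramifiedIn`).
[cite: NeukirchANT1999, Ch. III (2.12) Cor.] -/
private theorem not_dvd_discr_of_isPrime_span {q : ℕ} (hq : q.Prime) (hP : (Ideal.span {(q : 𝓞 K)}).IsPrime) :
    ¬ (q : ℤ) ∣ NumberField.discr K := by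
  have hqZ : Prime (q : ℤ) := Nat.prime_iff_prime_int.mp hq
  rw [NumberField.not_dvd_discr_iff_isUnramifiedIn K (𝓞 K) hqZ, Algebra.isUnramifiedIn_iff_forall_ramificationIdx_eq_one]
  intro P _ hPover
  set Q : Ideal (𝓞 K) := Ideal.span {(q : 𝓞 K)} with hQ_def
  have hQne : Q ≠ ⊥ := by
    rw [hQ_def, Ne, Ideal.span_singleton_eq_bot]
    exact_mod_cast hq.ne_zero
  have hQmax : Q.IsMaximal := hP.isMaximal hQne
  have hmap : (Ideal.span {(q : ℤ)}).map (algebraMap ℤ (𝓞 K)) = Q := by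
    rw [Ideal.map_span, Set.image_singleton, map_natCast]
  have hle : Q ≤ P := by
    rw [← hmap]
    exact Ideal.map_le_of_le_comap (le_of_eq hPover.over)
  have hPQ : P = Q := (hQmax.eq_of_le ‹P.IsPrime›.ne_top hle).symm
  have hne : Ideal.span {(q : ℤ)} ≠ ⊥ := by simpa using hqZ.ne_zero
  rw [← Ideal.ramificationIdx'_eq_ramificationIdx (Ideal.span {(q : ℤ)}) P hne]
  refine Ideal.ramificationIdx'_spec ?_ ?_
  · rw [hmap, hPQ, pow_one]
  · rw [hmap, hPQ]
    have hlt : Q ^ 2 < Q ^ 1 := Ideal.pow_right_strictAnti Q hQne hQmax.ne_top (by norm_num)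
    rw [pow_one] at hlt
    exact hlt.not_ge

end Inert

/-! ## §3 Definite Brandt data EXIST at every odd admissible level of cell β (set-up + Gross point of conductor `1`) -/

section Brandt

variable {K : Type} [Field K] [NumberField K] {W : WeierstrassCurve ℚ} [W.IsGloballyMinimal] {p : ℕ} [Fact p.Prime]

omit [NumberField K] [Fact p.Prime] in
/-- The K1-shaped product `∏ q ∈ s.image val, q` IS the level `∏ r ∈ s, r`. [folklore] -/
theorem prod_image_val_eq_prod (s : Finset (AdmQ W K p)) : (∏ q ∈ s.image Subtype.val, q) = ∏ r ∈ s, (r : ℕ) :=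
  Finset.prod_image fun _ _ _ _ hxy ↦ Subtype.ext hxy

omit [NumberField K] [Fact p.Prime] in
/-- **A definite set-up of type `(N, ∏s)` exists for every ODD admissible level `s`** (`N = N_E ≥ 1`; `∏s` square-free with an odd number of prime
factors and prime to `N`): the tree's `Brandt.nonempty_xiSetup_iff_admissible` (Vignéras III §3 Thm. 3.1 and the construction of Eichler orders).
[cite: VignerasLNM800, Ch. III §3 Thm. 3.1, §5] -/
theorem nonempty_xiSetup_of_odd {N : ℕ} [NeZero N] (hN : (N : ℤ) = W.conductorNorm ℤ) {s : Finset (AdmQ W K p)} (hs : Odd s.card) :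
    Nonempty (Brandt.XiSetup N (∏ r ∈ s, (r : ℕ))) := by
  have hN' : N = W.conductorNorm ℤ := by exact_mod_cast hN
  refine Brandt.nonempty_xiSetup_iff_admissible.mpr ⟨Nat.pos_of_ne_zero (NeZero.ne N), (prod_mem_admissibleProducts hN s).1,
    by rw [card_primeFactors_prod]; exact hs, Nat.Coprime.prod_right fun r _ ↦ ?_⟩
  have hr := r.2
  have hndvd : ¬ (r : ℕ) ∣ N := fun h ↦ hr.2.1 (h.trans (by rw [hN']; exact dvd_mul_left _ _))
  exact ((Nat.Prime.coprime_iff_not_dvd hr.1).mpr hndvd).symm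

omit [Fact p.Prime] in
/-- **★ DEFINITE BRANDT DATA EXIST at every odd admissible level of cell β**: for `N = N_E ≥ 1`, `K` imaginary quadratic with every `ℓ ∣ N` split and
`(N, d_K) = 1`, and an ODD finite set `s` of Bertolini–Darmon admissible primes (inert in `K`, prime to `pN`), there are a definite set-up
`S : Brandt.XiSetup N (∏ s)` AND a Gross point `(ψ, I)` of conductor `1` on it (`Brandt.IsGrossPoint S.O ψ I`) — §3's set-up existence + g33's
`GrossPointsGeneralLevel.exists_isGrossPoint` (BD96 Lemma 2.1 at arbitrary, possibly non-square-free, `N⁺ = N`), fed by §2 (admissible primes are inert: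
one prime above, prime to `d_K`).  Stated at K1's product `∏ q ∈ s.image val, q`. [cite: BertoliniDarmon1996, Lemma 2.1] [cite: VignerasLNM800, Ch. III §3 Thm. 3.1, §5 Thm. 5.11]
[cite: BertoliniDarmon2005, p. 18 (admissible primes)] -/
theorem exists_xiSetup_isGrossPoint {N : ℕ} [NeZero N] (hN : (N : ℤ) = W.conductorNorm ℤ) (hK : IsImaginaryQuadratic K)
    (hHeeg : ∀ ℓ : ℕ, ℓ.Prime → ℓ ∣ N → ((Ideal.span {(ℓ : ℤ)}).primesOver (𝓞 K)).ncard = 2)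
    (hND : IsCoprime (N : ℤ) (NumberField.discr K)) {s : Finset (AdmQ W K p)} (hs : Odd s.card) :
    ∃ (S : Brandt.XiSetup N (∏ q ∈ s.image Subtype.val, q)) (ψ : K →ₐ[ℚ] S.D) (I : Submodule ℤ S.D), Brandt.IsGrossPoint S.O ψ I := by
  rw [prod_image_val_eq_prod]
  obtain ⟨S⟩ := nonempty_xiSetup_of_odd (W := W) (K := K) (p := p) hN hs
  have hcopN : N.Coprime (NumberField.discr K).natAbs := by
    have h := Int.isCoprime_iff_gcd_eq_one.mp hND
    rwa [Int.gcd_eq_natAbs, Int.natAbs_natCast] at h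
  have hcopS : (∏ r ∈ s, (r : ℕ)).Coprime (NumberField.discr K).natAbs := by
    refine Nat.Coprime.prod_left fun r _ ↦ (Nat.Prime.coprime_iff_not_dvd r.2.1).mpr fun h ↦ ?_
    exact not_dvd_discr_of_isPrime_span r.2.1 r.2.2.2.1 (Int.dvd_natAbs.mp (Int.natCast_dvd_natCast.mpr h))
  have hinert : ∀ ℓ : ℕ, ℓ.Prime → ℓ ∣ (∏ r ∈ s, (r : ℕ)) → ((Ideal.span {(ℓ : ℤ)}).primesOver (𝓞 K)).ncard = 1 := by
    intro ℓ hℓ hℓs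
    obtain ⟨r, -, hℓr⟩ := (Nat.Prime.prime hℓ).exists_mem_finset_dvd hℓs
    rw [(Nat.prime_dvd_prime_iff_eq hℓ r.2.1).mp hℓr]
    exact ncard_primesOver_eq_one_of_isPrime_span r.2.1 r.2.2.2.1
  obtain ⟨ψ, I, h⟩ := GrossPointsGeneralLevel.exists_isGrossPoint S hK (Nat.Coprime.mul_left hcopN hcopS) hHeeg hinert
  exact ⟨S, ψ, I, h⟩

end Brandt

/-! ## §4 ★★★ The anchor from [NV]: K1's conclusion at EVERY odd zero vertex -/

section Anchor

variable {K : Type} [Field K] [NumberField K] {W : WeierstrassCurve ℚ} [W.IsElliptic] [W.IsGloballyMinimal] {p : ℕ} [Fact p.Prime]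
  {κ : ZpExtension K p} {γ : absoluteGaloisGroup K} {N : ℕ} {ε : ℤˣ} {B : SignedBipartiteSystem W K p κ} {𝔭 𝔭' : HeightOneSpectrum (𝓞 K)}
  (c : K ≃ₐ[ℚ] K) [Module (ZMod p) (Vp W K p)]

/-- ★★★ **THE ANCHOR FROM [NV] (K1 ⟸ [NV] on cell β, in kernel).**  Frame: CHKLL25's signed bipartite system `B` of sign `ε` at level `N = N_E ≥ 1`
(`hB`), `AcSigned.Setting`, {HLV 3.7 local}, `p ≥ 5`, `ρ̄` onto, every `ℓ ∣ N` split, `p` split, `(N, d_K) = 1`, binder (ii) «`E[p]` ramified at every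
`q ∣ N`», `c ≠ 1`, odd bottom dimension ((Par)), and the DICTIONARY clause of cite (16) for THIS system (`hdict`: at every `m ∈ 𝒩_1^def` and every
set-up of type `(N, m)` a non-zero mod-`p` `a(E)`-eigenvector `φ_g` with «`λ_1(m)(0) ∈ ℤ_pˣ ⟺` weighted toric period of `φ_g` at any Gross point `≠ 0`»,
CHKLL25 Thm. 7.4 with (7.4), W. Zhang Thm. 9.1's reading).  THEN [NV] `B.HasUnitLambda N` gives, at EVERY odd zero vertex `s` of the level-raised Selmer
walk (`SelQP W K p c s ± = ⊥`), **definite Brandt data at level `N·∏s` with NON-ZERO WEIGHTED toric period**: `∃ S ψ I φ`, `Brandt.IsGrossPoint S.O ψ I`,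
`φ ∈ eigenSpace (ZMod p) (N·∏s) (Brandt.matrix S.O) (a(E))`, `toricPeriod S.O ψ I (w • φ) ≠ 0` — EXACTLY the conclusion of the anchor K1
(`…DefiniteAnchorDefs.DefiniteAnchorNonFW`, item stmt-BirchSwinnertonDyer-33118) at its own product `∏ q ∈ s.image val, q`.  Proof: §1 (Howard 3.2.3 (c) mod 𝔪,
PT-free) gives `λ_1(∏s)(0) ∈ ℤ_pˣ`; §3 gives a set-up and a Gross point; the dictionary converts.  [NV] and `hdict` are HYPOTHESES; nothing here proves K1.
[cite: Howard2006, Thm. 3.2.3 (c)] [cite: CastellaEtAl2025, Thm. 7.4, (7.4), Thm. 7.5, §7.4 (arXiv:2308.10474v2 pp. 30–33)] [cite: WZhang2014, Thm. 9.1]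
[cite: BertoliniDarmon1996, Lemma 2.1] [cite: HatleyLeiVigni2022, Lemma 3.7] -/
theorem anchor_of_hasUnitLambda [NeZero N] (hB : IsSignedBipartiteSystem W K p κ γ N ε B) (hS : Setting W K p κ 𝔭 𝔭')
    (hloc : hatleyLeiVigni2022_lemma37_local_signedCondition_eq_kummer W K p κ 𝔭 𝔭')
    (hN : (N : ℤ) = W.conductorNorm ℤ) (h5 : 5 ≤ p) (hsurj : W.HasSurjectiveModNGaloisRep p)
    (hHeeg : ∀ ℓ : ℕ, ℓ.Prime → ℓ ∣ N → ((Ideal.span {(ℓ : ℤ)}).primesOver (𝓞 K)).ncard = 2)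
    (hsp : ((Ideal.span {(p : ℤ)}).primesOver (𝓞 K)).ncard = 2) (hND : IsCoprime (N : ℤ) (NumberField.discr K))
    (hall : ∀ q : ℕ, q.Prime → q ∣ N → ∃ v' : HeightOneSpectrum (𝓞 ℚ), ((q : ℕ) : 𝓞 ℚ) ∈ v'.asIdeal ∧
      ∃ 𝔓 ∈ v'.primesAbove, ∃ σ ∈ 𝔓.inertia (absoluteGaloisGroup ℚ), ∃ P : W.geomTorsion (p : ℤ), σ • P ≠ P)
    (hc1 : c ≠ 1) (hodd : Odd (finrank (ZMod p) (SelQP W K p c ∅ true) + finrank (ZMod p) (SelQP W K p c ∅ false)))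
    (hdict : ∀ m ∈ defProducts N K (fun ℓ ↦ W.frobeniusTrace ℓ) p 1, ∀ (S : Brandt.XiSetup N m),
      ∃ φ : Brandt.ClassSet S.O → ZMod p, φ ≠ 0 ∧
        (letI : Fintype (Brandt.ClassSet S.O) := Fintype.ofFinite _
         φ ∈ Brandt.eigenSpace (ZMod p) (N * m) (Brandt.matrix S.O) (fun ℓ ↦ W.frobeniusTrace ℓ)) ∧
        ∀ (ψ : K →ₐ[ℚ] S.D) (I : Submodule ℤ S.D), Brandt.IsGrossPoint S.O ψ I →
          (IsUnit (PowerSeries.constantCoeff (B.lam 1 m)) ↔ Brandt.toricPeriod S.O ψ I (fun i ↦ (Brandt.weight S.O i : ZMod p) * φ i) ≠ 0))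
    (hNV : B.HasUnitLambda N)
    {s : Finset (AdmQ W K p)} (hs : Odd s.card) (hzero : ∀ μ : Bool, SelQP W K p c s μ = ⊥) :
    ∃ (S : Brandt.XiSetup N (∏ q ∈ s.image Subtype.val, q)) (ψ : K →ₐ[ℚ] S.D) (I : Submodule ℤ S.D)
      (φ : Brandt.ClassSet S.O → ZMod p),
      Brandt.IsGrossPoint S.O ψ I ∧
      (letI : Fintype (Brandt.ClassSet S.O) := Fintype.ofFinite _
       φ ∈ Brandt.eigenSpace (ZMod p) (N * ∏ q ∈ s.image Subtype.val, q) (Brandt.matrix S.O) (fun ℓ ↦ W.frobeniusTrace ℓ)) ∧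
      Brandt.toricPeriod S.O ψ I (fun i ↦ (Brandt.weight S.O i : ZMod p) * φ i) ≠ 0 := by
  have hN' : N = W.conductorNorm ℤ := by exact_mod_cast hN
  have hH : SatisfiesHeegnerHypothesis (W.conductorNorm ℤ) K := fun ℓ hℓ hℓN ↦ hHeeg ℓ hℓ (hN' ▸ hℓN)
  -- λ_1(∏s)(0) is a unit (Howard 3.2.3 (c) mod 𝔪 on β, PT-free)
  have hlam := isUnit_lam_of_hasUnitLambda_of_selQP_eq_bot' c hB hS hloc hN h5 hsurj hH hsp hND hall hc1 hodd hNV hs hzero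
  -- the set-up and the Gross point exist
  obtain ⟨S, ψ, I, hG⟩ := exists_xiSetup_isGrossPoint (W := W) (K := K) (p := p) hN hS.isImaginaryQuadratic hHeeg hND hs
  -- the dictionary at `m = ∏ s ∈ 𝒩_1^def`
  have hm : (∏ q ∈ s.image Subtype.val, q) ∈ defProducts N K (fun ℓ ↦ W.frobeniusTrace ℓ) p 1 := by
    rw [prod_image_val_eq_prod]; exact prod_mem_defProducts_of_odd hN hs
  obtain ⟨φ, -, hφ, hiff⟩ := hdict _ hm S
  refine ⟨S, ψ, I, φ, hG, hφ, (hiff ψ I hG).mp ?_⟩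
  rw [prod_image_val_eq_prod]
  exact hlam

/-- ★★★ **The anchor from [NV], binder shape of the line** ((Par) DISCHARGED: Cassels–Tate is a tree theorem, `rk_p(E/K)` odd is the named print fact
Dokchitser–Dokchitser 2010 §4.6 step (4), as in `…AdmdefHowardRigidity.…_of_dokchitser`; `ρ̄` onto as `Rank1Residual.Surj`).  Same conclusion as
`anchor_of_hasUnitLambda`. [cite: Howard2006, Thm. 3.2.3 (c)] [cite: CastellaEtAl2025, Thm. 7.4, Thm. 7.5, §7.4] [cite: DokchitserDokchitserAnnals2010, §4.6, Thm. 4.19]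
[cite: BertoliniDarmon1996, Lemma 2.1] [cite: HatleyLeiVigni2022, Lemma 3.7] -/
theorem anchor_of_hasUnitLambda_of_dokchitser [NeZero N] (hDD : dokchitser_selmerCorank_baseChange_mod_two_eq)
    (hB : IsSignedBipartiteSystem W K p κ γ N ε B) (hS : Setting W K p κ 𝔭 𝔭')
    (hloc : hatleyLeiVigni2022_lemma37_local_signedCondition_eq_kummer W K p κ 𝔭 𝔭')
    (hN : (N : ℤ) = W.conductorNorm ℤ) (h5 : 5 ≤ p) (hsurj : Surj W p)
    (hHeeg : ∀ ℓ : ℕ, ℓ.Prime → ℓ ∣ N → ((Ideal.span {(ℓ : ℤ)}).primesOver (𝓞 K)).ncard = 2)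
    (hsp : ((Ideal.span {(p : ℤ)}).primesOver (𝓞 K)).ncard = 2) (hND : IsCoprime (N : ℤ) (NumberField.discr K))
    (hall : ∀ q : ℕ, q.Prime → q ∣ N → ∃ v' : HeightOneSpectrum (𝓞 ℚ), ((q : ℕ) : 𝓞 ℚ) ∈ v'.asIdeal ∧
      ∃ 𝔓 ∈ v'.primesAbove, ∃ σ ∈ 𝔓.inertia (absoluteGaloisGroup ℚ), ∃ P : W.geomTorsion (p : ℤ), σ • P ≠ P)
    (hc1 : c ≠ 1)
    (hdict : ∀ m ∈ defProducts N K (fun ℓ ↦ W.frobeniusTrace ℓ) p 1, ∀ (S : Brandt.XiSetup N m),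
      ∃ φ : Brandt.ClassSet S.O → ZMod p, φ ≠ 0 ∧
        (letI : Fintype (Brandt.ClassSet S.O) := Fintype.ofFinite _
         φ ∈ Brandt.eigenSpace (ZMod p) (N * m) (Brandt.matrix S.O) (fun ℓ ↦ W.frobeniusTrace ℓ)) ∧
        ∀ (ψ : K →ₐ[ℚ] S.D) (I : Submodule ℤ S.D), Brandt.IsGrossPoint S.O ψ I →
          (IsUnit (PowerSeries.constantCoeff (B.lam 1 m)) ↔ Brandt.toricPeriod S.O ψ I (fun i ↦ (Brandt.weight S.O i : ZMod p) * φ i) ≠ 0))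
    (hNV : B.HasUnitLambda N)
    {s : Finset (AdmQ W K p)} (hs : Odd s.card) (hzero : ∀ μ : Bool, SelQP W K p c s μ = ⊥) :
    ∃ (S : Brandt.XiSetup N (∏ q ∈ s.image Subtype.val, q)) (ψ : K →ₐ[ℚ] S.D) (I : Submodule ℤ S.D)
      (φ : Brandt.ClassSet S.O → ZMod p),
      Brandt.IsGrossPoint S.O ψ I ∧
      (letI : Fintype (Brandt.ClassSet S.O) := Fintype.ofFinite _
       φ ∈ Brandt.eigenSpace (ZMod p) (N * ∏ q ∈ s.image Subtype.val, q) (Brandt.matrix S.O) (fun ℓ ↦ W.frobeniusTrace ℓ)) ∧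
      Brandt.toricPeriod S.O ψ I (fun i ↦ (Brandt.weight S.O i : ZMod p) * φ i) ≠ 0 := by
  have hCT : ∀ (K : Type) [Field K] [NumberField K], WeierstrassCurve.exists_casselsTate_pairing (K := K) :=
    fun K _ _ ↦ GenusExact.CasselsTatePTcReal.exists_casselsTate_pairing_of_levelThetaDatum (K := K)
      fun V _ k hk _ e hμ hadd₁ hadd₂ _hgal halt _hnd =>
        ⟨levelThetaDatumEven V (2 ^ k) e hμ hadd₁ hadd₂ halt (Nat.even_pow.mpr ⟨even_two, hk.ne'⟩)⟩
  have hodd := SignedBaseChangeAcDivAdmdefOddSelmerDim.oddSelmerDim_of_casselsTate_of_dokchitser hCT hDD W K hN h5 hsurj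
    hS.isImaginaryQuadratic hHeeg c hc1
  exact anchor_of_hasUnitLambda c hB hS hloc hN h5 hsurj hHeeg hsp hND hall hc1 hodd hdict hNV hs hzero

end Anchor

end Summit.BirchSwinnertonDyer.BirchSwinnertonDyer.Theorems.SignedBaseChangeAcDivAdmdefAnchorOfNV

end
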